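import Literature.Analysis.Matrix.EigenvalueCountCertificates
import HarnessLib

/-!
# Eigenvalue counts of a symmetric-definite pencil from ONE shifted matrix: slack transfer `τ ↦ τ/β`

The bookkeeping behind certified counts for a symmetric-definite PENCIL `(A, B)` (FE stiffness / mass,
`B` symmetric with `xᵀBx ≥ β·xᵀx`, `β > 0`).  A sparse `LDLᵀ`-with-residual certificate (Golub–Van Loan
§8.4.2 spectrum slicing; tree `EigenvalueCount.card_eigenvalues_gt_add_le_card_pos_of_residual` /
`card_pos_le_card_eigenvalues_gt_sub_of_residual`) bounds the eigenvalue COUNTS of the single shifted matrix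
`W := A − s·B` up to a slack `τ`:  `#{i | τ < λᵢ(W)} ≤ n − ν ≤ #{i | −τ < λᵢ(W)}`.  Since `(τ/β)·B ⪰ τ·1`,
Weyl's monotonicity principle (Horn–Johnson Cor. 4.3.12 / (4.3.16), tree
`EigenvalueCount.card_filter_gt_add_le_of_forall_le` and its mirror) transfers these counts to the
NEIGHBOURING SHIFTS of the pencil:

* `card_pos_sub_shift_up_le` :     `#{i | 0 < λᵢ(A − (s + τ/β)·B)} ≤ #{i | τ < λᵢ(A − s·B)}`,
* `card_gt_neg_le_card_pos_sub_shift_down` : `#{i | −τ < λᵢ(A − s·B)} ≤ #{i | 0 < λᵢ(A − (s − τ/β)·B)}`,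
* `pencil_counts_of_shifted_count` : both composed with a count `ν` as above.

By Sylvester's law for the definite pencil, `#{i | 0 < λᵢ(A − t·B)}` is the number of pencil eigenvalues
above `t`; so the corollary reads «at most `n − ν` pencil eigenvalues exceed `s + τ/β` and at least `n − ν`
exceed `s − τ/β`» — exactly `ν` pencil eigenvalues below the cut, up to the slack `τ/β`.  Everything is
proved; no floating point appears (the certificate supplies the count hypothesis).  NOT here: the
identification of `#{0 < λᵢ(A − tB)}` with an enumeration of pencil eigenvalues (clients that enumerate the
pencil spectrum apply Sylvester's law with `B^{1/2}`; this file deliberately stays with the matrices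
`A − t·B`, which is what a certificate reader evaluates).

## References
* [HornJohnson2013] R. A. Horn, C. R. Johnson, *Matrix Analysis*, 2nd ed. (2013), Cor. 4.3.12 and
  Cor. 4.3.15 / (4.3.16) (Weyl monotonicity) — the transfer step.
* [GolubVanLoan2013] G. H. Golub, C. F. Van Loan, *Matrix Computations*, 4th ed. (2013), §8.4.2
  (`LDLᵀ` counts) and §8.7.1 (the symmetric-definite generalized eigenproblem) — the setting.
-/

namespace Literature.Analysis.Matrix

namespace PencilCount

open Finset _root_.Matrix EigenvalueCount

variable {ι : Type*} [Fintype ι] [DecidableEq ι]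
variable {A B : Matrix ι ι ℝ} {s τ β : ℝ}

omit [Fintype ι] [DecidableEq ι] in
/-- `A − t·B` is symmetric when `A`, `B` are (private helper). [folklore] -/
private theorem isHermitian_sub_smul (hA : A.IsHermitian) (hB : B.IsHermitian) (t : ℝ) :
    (A - t • B).IsHermitian :=
  hA.sub (IsHermitian.smul hB (by rw [IsSelfAdjoint, star_trivial]))

omit [DecidableEq ι] in
/-- Quadratic form of the difference of two shifts: `xᵀ((A − t·B) − (A − s·B))x = (s − t)·xᵀBx`
(private helper). [folklore] -/
private theorem dotProduct_sub_shift_mulVec (s t : ℝ) (x : ι → ℝ) :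
    x ⬝ᵥ ((A - t • B) - (A - s • B)) *ᵥ x = (s - t) * (x ⬝ᵥ B *ᵥ x) := by
  have : (A - t • B) - (A - s • B) = (s - t) • B := by
    rw [sub_smul]; abel
  rw [this, smul_mulVec, dotProduct_smul, smul_eq_mul]

/-- **Slack transfer, upper side.** If `B` is symmetric with `β·xᵀx ≤ xᵀBx` for all `x` (`β > 0`) and
`τ ≥ 0`, then every eigenvalue count of `A − (s + τ/β)·B` above `0` is dominated by the count of
`A − s·B` above `τ`:  `#{i | 0 < λᵢ(A − (s + τ/β)B)} ≤ #{i | τ < λᵢ(A − sB)}` — because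
`(A − (s + τ/β)B) − (A − sB) = −(τ/β)·B ⪯ −τ·1`. [cite: HornJohnson2013, Cor. 4.3.12 / (4.3.16) (Weyl monotonicity)] -/
theorem card_pos_sub_shift_up_le (hA : A.IsHermitian) (hB : B.IsHermitian) (hβ : 0 < β)
    (hBβ : ∀ x : ι → ℝ, β * (x ⬝ᵥ x) ≤ x ⬝ᵥ B *ᵥ x) (hτ : 0 ≤ τ) (s : ℝ) :
    (univ.filter fun i => 0 < (isHermitian_sub_smul hA hB (s + τ / β)).eigenvalues i).card ≤
      (univ.filter fun i => τ < (isHermitian_sub_smul hA hB s).eigenvalues i).card := by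
  have h := card_filter_gt_add_le_of_forall_le (θ := τ) (r := -τ) (isHermitian_sub_smul hA hB s)
    (isHermitian_sub_smul hA hB (s + τ / β)) (fun x => ?_)
  · simpa using h
  · rw [dotProduct_sub_shift_mulVec]
    have hx : 0 ≤ x ⬝ᵥ x := by
      simpa [dotProduct] using Finset.sum_nonneg fun i _ => mul_self_nonneg (x i)
    have hcoef : s - (s + τ / β) = -(τ / β) := by ring
    rw [hcoef]
    have hBx := hBβ x
    have : τ / β * (x ⬝ᵥ B *ᵥ x) ≥ τ / β * (β * (x ⬝ᵥ x)) :=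
      mul_le_mul_of_nonneg_left hBx (div_nonneg hτ hβ.le)
    have hsimp : τ / β * (β * (x ⬝ᵥ x)) = τ * (x ⬝ᵥ x) := by
      field_simp
    nlinarith [this, hsimp]

/-- **Slack transfer, lower side.** Under the same hypotheses,
`#{i | −τ < λᵢ(A − sB)} ≤ #{i | 0 < λᵢ(A − (s − τ/β)B)}` — because
`(A − sB) − (A − (s − τ/β)B) = −(τ/β)·B ⪯ −τ·1`. [cite: HornJohnson2013, Cor. 4.3.12 / (4.3.16) (Weyl monotonicity)] -/
theorem card_gt_neg_le_card_pos_sub_shift_down (hA : A.IsHermitian) (hB : B.IsHermitian) (hβ : 0 < β)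
    (hBβ : ∀ x : ι → ℝ, β * (x ⬝ᵥ x) ≤ x ⬝ᵥ B *ᵥ x) (hτ : 0 ≤ τ) (s : ℝ) :
    (univ.filter fun i => -τ < (isHermitian_sub_smul hA hB s).eigenvalues i).card ≤
      (univ.filter fun i => 0 < (isHermitian_sub_smul hA hB (s - τ / β)).eigenvalues i).card := by
  have h := card_filter_gt_add_le_of_forall_le (θ := 0) (r := -τ) (isHermitian_sub_smul hA hB (s - τ / β))
    (isHermitian_sub_smul hA hB s) (fun x => ?_)
  · simpa using h
  · rw [dotProduct_sub_shift_mulVec]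
    have hcoef : s - τ / β - s = -(τ / β) := by ring
    rw [hcoef]
    have hBx := hBβ x
    have : τ / β * (x ⬝ᵥ B *ᵥ x) ≥ τ / β * (β * (x ⬝ᵥ x)) :=
      mul_le_mul_of_nonneg_left hBx (div_nonneg hτ hβ.le)
    have hsimp : τ / β * (β * (x ⬝ᵥ x)) = τ * (x ⬝ᵥ x) := by
      field_simp
    nlinarith [this, hsimp]

/-- **Pencil counts from one shifted-matrix count.** Let `A`, `B` be real symmetric, `β·xᵀx ≤ xᵀBx`
(`β > 0`), `τ ≥ 0`, and suppose a certificate for `W = A − s·B` gives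
`#{i | τ < λᵢ(W)} ≤ n − ν` and `n − ν ≤ #{i | −τ < λᵢ(W)}` (tree: the residual `LDLᵀ` count
certificate). Then `#{i | 0 < λᵢ(A − (s + τ/β)B)} ≤ n − ν ≤ #{i | 0 < λᵢ(A − (s − τ/β)B)}`: by Sylvester's
law for the definite pencil these are the numbers of pencil eigenvalues above `s + τ/β` resp. `s − τ/β`,
i.e. exactly `ν` pencil eigenvalues lie below the cut `s` up to the slack `τ/β`.
[cite: GolubVanLoan2013, §8.4.2 with §8.7.1 (spectrum slicing for the symmetric-definite pencil)] -/
theorem pencil_counts_of_shifted_count (hA : A.IsHermitian) (hB : B.IsHermitian) (hβ : 0 < β)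
    (hBβ : ∀ x : ι → ℝ, β * (x ⬝ᵥ x) ≤ x ⬝ᵥ B *ᵥ x) (hτ : 0 ≤ τ) (s : ℝ) {m : ℕ}
    (hup : (univ.filter fun i => τ < (isHermitian_sub_smul hA hB s).eigenvalues i).card ≤ m)
    (hlow : m ≤ (univ.filter fun i => -τ < (isHermitian_sub_smul hA hB s).eigenvalues i).card) :
    (univ.filter fun i => 0 < (isHermitian_sub_smul hA hB (s + τ / β)).eigenvalues i).card ≤ m ∧
      m ≤ (univ.filter fun i => 0 < (isHermitian_sub_smul hA hB (s - τ / β)).eigenvalues i).card :=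
  ⟨(card_pos_sub_shift_up_le hA hB hβ hBβ hτ s).trans hup,
    hlow.trans (card_gt_neg_le_card_pos_sub_shift_down hA hB hβ hBβ hτ s)⟩

end PencilCount

end Literature.Analysis.Matrix
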